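import Mathlib
import Summits.Ventures.PercRepro.PuncturedLYMMixT1Q5Table1
import Summits.Ventures.PercRepro.PuncturedLYMMixT1Q5Table2

/-!
# PercRepro — (SP) FOR `1` PAIRWISE DISJOINT TRIPLES AND `5` PAIRWISE DISJOINT QUADRUPLES AT LEVEL `4`: POSITIVITY OF THE DENOMINATORS (1)
(p10, gen 41)

`den > 0`, `Pc > 0` for `n ≥ 23`; `Yc > 0` for `n ≥ 5`.  Nothing here asserts (SP).
-/

namespace PercRepro.PuncturedLYM.Split.TypeLift.MixT1Q5

/-- `den > 0` for `n ≥ 23`. -/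
theorem den_pos (n : ℚ) (hn : 23 ≤ n) : 0 < den n := by
  obtain ⟨n', hn', rfl⟩ : ∃ n', 0 ≤ n' ∧ n = 23 + n' := ⟨n - 23, by linarith, by ring⟩
  have h : den (23 + n') = 20736 * n' ^ 14 + 6238080 * n' ^ 13 + 871139664 * n' ^ 12 + 74850074208 * n' ^ 11 + 4420643559732 * n' ^ 10 + 189839718844500 * n' ^ 9 + 6113016993750408 * n' ^ 8 + 149942550646074360 * n' ^ 7 + 2815169387247047652 * n' ^ 6 + 40259928787776935364 * n' ^ 5 + 431702474512098997968 * n' ^ 4 + 3365647124623050249360 * n' ^ 3 + 18034067071869119240640 * n' ^ 2 + 59446552551218516418048 * n' + 90949203347881019719680 := by unfold den; ring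
  rw [h]; positivity

/-- `Yc > 0` for `n ≥ 5`. -/
theorem Yc_pos (n : ℚ) (hn : 5 ≤ n) : 0 < Yc n := by
  obtain ⟨n', hn', rfl⟩ : ∃ n', 0 ≤ n' ∧ n = 5 + n' := ⟨n - 5, by linarith, by ring⟩
  have h : Yc (5 + n') = (1 / 120) * n' ^ 5 + (1 / 8) * n' ^ 4 + (17 / 24) * n' ^ 3 + (15 / 8) * n' ^ 2 + (137 / 60) * n' + 1 := by unfold Yc; ring
  rw [h]; positivity

/-- `Pc > 0` for `n ≥ 23`. -/
theorem Pc_pos (n : ℚ) (hn : 23 ≤ n) : 0 < Pc n := by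
  obtain ⟨n', hn', rfl⟩ : ∃ n', 0 ≤ n' ∧ n = 23 + n' := ⟨n - 23, by linarith, by ring⟩
  have h : Pc (23 + n') = (1 / 24) * n' ^ 4 + (43 / 12) * n' ^ 3 + (2771 / 24) * n' ^ 2 + (19811 / 12) * n' + 8830 := by unfold Pc; ring
  rw [h]; positivity

end PercRepro.PuncturedLYM.Split.TypeLift.MixT1Q5
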